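import Literature.NumberTheory.LFunctions.Zhang2022.TypedSection01and02A

/-!
# Zhang (2022) rescue catalogue — AUTHOR-SIDE statements: the 2007 predecessor's Theorems 1–2
# (`(log D)^{-A}(log log D)^{-1}` shapes) and the exponent claims, as typed hypotheses with their
# kernel edges to the tree's `Skeleton.LOneLowerBound` / `Skeleton.ZeroFreeRegion`

Topic `Literature/NumberTheory/LFunctions/Zhang2022` (Landau–Siegel audit tree; verdict-neutral), cell
landau-siegel, D-0124 LS RESCUE PROTOCOL (2) REPAIR-CATALOGUE, typer seat ls-rescue-typ-1. Y. Zhang,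
*Discrete mean estimates and the Landau–Siegel zero*, arXiv:2211.02515v1 (2022) [Zhang2022LandauSiegel] and its
predecessor *On the Landau–Siegel zeros conjecture*, arXiv:0705.4306v1 (2007) [Zhang2007LandauSiegel] — both
unrefereed manuscripts (the author called the 2007 text "incomplete" in 2013). **Nothing in this file asserts or
denies any of their theorems; every catalogue row is a claim-tagged HYPOTHESIS `def … : Prop`, never a fact.
The programme SEARCHES and TYPES; no claim about Landau–Siegel zeros, Theorems 1–2 of arXiv:2211.02515 or a
repaired Margin232 until a kernel theorem says so.**

## What the sources say (verbatim)

* arXiv:0705.4306v1 §1 (held text `paper:arxiv-0705.4306` p0002 L5–L8): "Theorem 1. For any real primitive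
  character `χ` of modulus `D` we have `L(1,χ) > c₁(log D)^{-17}(log log D)^{-1}` (1.1) where `c₁ > 0` is an
  absolute, effectively computable constant." L13–L24: "As a direct consequence of Theorem 1, we have Theorem 2.
  … `L(σ,χ) ≠ 0` for `σ > 1 − c₂(log D)^{-19}(log log D)^{-1}`". L29: "With extra effort we can replace the
  factor `(log log D)^{-1}` in the above results by one; even the powers of `(log D)^{-1}` might be slightly
  improved." L49: assumption "(A1) `L(1,χ) < (log D)^{-17}(log log D)^{-1}`".
* arXiv:2211.02515v1 §1: Theorem 1 `L(1,χ) > c₁(log D)^{-2022}`, Theorem 2 `σ > 1 − c₂(log D)^{-2024}` — the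
  tree's `Skeleton.Theorem1 = LOneLowerBound 2022`, `Skeleton.Theorem2 = ZeroFreeRegion 2024` (CITED, not restated).

## How it is typed

* `LOneLowerBoundLogLog A`, `ZeroFreeRegionLogLog A` — the 2007 SHAPES with the extra `(log log D)^{-1}`, in the
  binder conventions of `Skeleton.LOneLowerBound` (moduli `D ≥ 3`, Mathlib `IsQuadratic`/`IsPrimitive`, `‖L(1,χ)‖`;
  for `D ≥ 3`, `log log D ≥ log log 3 > 0`, `loglog_pos_of_three_le`, so no junk division).
* `zhang2007Theorem1 := LOneLowerBoundLogLog 17`, `zhang2007Theorem2 := ZeroFreeRegionLogLog 19` — the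
  predecessor's CLAIMS (catalogue: version row «2007 v1»); the L29 remark is the pair of INSTANCES
  `Skeleton.LOneLowerBound 17` / `Skeleton.ZeroFreeRegion 19` (no new declaration).
* `ExponentBelow B := ∃ A < B, Skeleton.LOneLowerBound A` — the shape of the relayed author statement that the
  method "could get the exponent down to less than `B`" (catalogue row supplies the source and `B`).
* PROVED kernel edges (the catalogue's KERNEL-CLOSE doors / sandwich): `…LogLog A` sits between exponent `A` and
  `A + 1` (`lOneLowerBoundLogLog_of_lOneLowerBound`, `lOneLowerBound_succ_of_logLog`, the same for `ZeroFreeRegion…`),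
  `zeroFreeRegion_mono`, hence `theorem1_of_zhang2007Theorem1` (the 2007 claim is STRONGER than the 2022 Theorem 1),
  `theorem2_of_zhang2007Theorem2`, `theorem1_of_exponentBelow` (`B ≤ 2023`).

WHAT THIS IS NOT: a verdict on any row (ls-rescue-ref-1 / ls-rescue-lead own the battery columns); no statement
about Landau–Siegel zeros.

## References

* [Zhang2007LandauSiegel] Y. Zhang, arXiv:0705.4306v1 (2007), §1 Theorems 1–2, (1.1), (A1), remark after Theorem 2.
* [Zhang2022LandauSiegel] Y. Zhang, arXiv:2211.02515v1 (2022), §1 Theorems 1–2 (tree: `SkeletonSetting`).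
-/

noncomputable section

open Real

namespace Literature.NumberTheory.LFunctions.Zhang2022.Repair.Catalogue

open Literature.NumberTheory.LFunctions.Zhang2022

/-! ## Elementary facts about `log log D` for `D ≥ 3` (private plumbing) -/

/-- `1 < log D` for `D ≥ 3` (`e < 2.72 < 3`). [folklore] -/
private theorem one_lt_log_of_three_le {D : ℕ} (hD : 3 ≤ D) : 1 < Real.log (D : ℝ) := by
  have hD' : (3 : ℝ) ≤ (D : ℝ) := by exact_mod_cast hD
  rw [Real.lt_log_iff_exp_lt (by linarith)]
  have := Real.exp_one_lt_d9
  linarith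

/-- `0 < log log D` for `D ≥ 3`. [folklore] -/
private theorem loglog_pos_of_three_le {D : ℕ} (hD : 3 ≤ D) : 0 < Real.log (Real.log (D : ℝ)) :=
  Real.log_pos (one_lt_log_of_three_le hD)

/-- `log log 3 ≤ log log D` for `D ≥ 3`. [folklore] -/
private theorem loglog_three_le {D : ℕ} (hD : 3 ≤ D) :
    Real.log (Real.log 3) ≤ Real.log (Real.log (D : ℝ)) := by
  have hD' : (3 : ℝ) ≤ (D : ℝ) := by exact_mod_cast hD
  have h3 : 1 < Real.log (3 : ℝ) := by
    have := one_lt_log_of_three_le (le_refl 3)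
    simpa using this
  apply Real.log_le_log (by linarith)
  exact Real.log_le_log (by norm_num) hD'

/-- `0 < log log 3`. [folklore] -/
private theorem loglog_three_pos : 0 < Real.log (Real.log (3 : ℝ)) := by
  have := loglog_pos_of_three_le (le_refl 3)
  simpa using this

/-- `log log D ≤ log D` whenever `0 < log D` (`log x ≤ x − 1`). [folklore] -/
private theorem loglog_le_log {D : ℕ} (h : 0 < Real.log (D : ℝ)) :
    Real.log (Real.log (D : ℝ)) ≤ Real.log (D : ℝ) := by
  have := Real.log_le_sub_one_of_pos h
  linarith

/-! ## The 2007 shapes: an extra factor `(log log D)^{-1}` -/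

/-- The shape of the 2007 Theorem 1 with a general exponent `A`: an absolute `c₁ > 0` with
`L(1,χ) > c₁ (log D)^{-A} (log log D)^{-1}` for every real primitive `χ` to a modulus `D ≥ 3` (binder
conventions of `Skeleton.LOneLowerBound`). [cite: Zhang2007LandauSiegel, §1 Theorem 1 (1.1)] -/
def LOneLowerBoundLogLog (A : ℕ) : Prop :=
  ∃ c₁ : ℝ, 0 < c₁ ∧ ∀ (D : ℕ) [NeZero D] (χ : DirichletCharacter ℂ D),
    3 ≤ D → χ.IsQuadratic → χ.IsPrimitive →
      c₁ / (Real.log D ^ A * Real.log (Real.log D)) < ‖χ.LFunction 1‖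

/-- The shape of the 2007 Theorem 2 with a general exponent `A`: an absolute `c₂ > 0` with `L(σ,χ) ≠ 0` for
`σ > 1 − c₂ (log D)^{-A} (log log D)^{-1}`, every real primitive `χ` mod `D ≥ 3` (binder conventions of
`Skeleton.ZeroFreeRegion`). [cite: Zhang2007LandauSiegel, §1 Theorem 2] -/
def ZeroFreeRegionLogLog (A : ℕ) : Prop :=
  ∃ c₂ : ℝ, 0 < c₂ ∧ ∀ (D : ℕ) [NeZero D] (χ : DirichletCharacter ℂ D),
    3 ≤ D → χ.IsQuadratic → χ.IsPrimitive →
      ∀ σ : ℝ, 1 - c₂ / (Real.log D ^ A * Real.log (Real.log D)) < σ → χ.LFunction σ ≠ 0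

/-- **Theorem 1 of the 2007 predecessor** (arXiv:0705.4306v1 §1 (1.1)): "`L(1,χ) > c₁(log D)^{-17}(log log D)^{-1}`
where `c₁ > 0` is an absolute, effectively computable constant." A CLAIM of an unrefereed manuscript its author
later called incomplete — stated, not asserted (catalogue version row «2007»).
[cite: Zhang2007LandauSiegel, §1 Theorem 1 (1.1)] -/
@[claim "Zhang2007LandauSiegel" "disputed"]
def zhang2007Theorem1 : Prop := LOneLowerBoundLogLog 17

/-- **Theorem 2 of the 2007 predecessor** (arXiv:0705.4306v1 §1): "`L(σ,χ) ≠ 0` for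
`σ > 1 − c₂(log D)^{-19}(log log D)^{-1}`". A CLAIM — stated, not asserted.
[cite: Zhang2007LandauSiegel, §1 Theorem 2] -/
@[claim "Zhang2007LandauSiegel" "disputed"]
def zhang2007Theorem2 : Prop := ZeroFreeRegionLogLog 19

/-- The shape of the relayed author statement «the method could get the exponent down to less than `B`»:
some exponent `A < B` with `L(1,χ) > c₁ (log D)^{-A}` for all real primitive `χ` (`Skeleton.LOneLowerBound A`).
A HYPOTHESIS shape for catalogue rows; the row supplies `B` and the source. [cite: Zhang2022LandauSiegel, §1 Theorem 1] -/
def ExponentBelow (B : ℕ) : Prop := ∃ A : ℕ, A < B ∧ Skeleton.LOneLowerBound A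

/-! ## Kernel edges: the `log log` shapes sit between exponents `A` and `A + 1` -/

/-- `(log D)^{-A}` lower bound ⇒ the `(log D)^{-A}(log log D)^{-1}` lower bound (`log log D ≥ log log 3 > 0`;
take `c₁' = c₁ · log log 3`). [cite: Zhang2007LandauSiegel, §1 remark after Theorem 2] -/
theorem lOneLowerBoundLogLog_of_lOneLowerBound {A : ℕ} (h : Skeleton.LOneLowerBound A) :
    LOneLowerBoundLogLog A := by
  obtain ⟨c₁, hc₁, h⟩ := h
  refine ⟨c₁ * Real.log (Real.log 3), mul_pos hc₁ loglog_three_pos, fun D _ χ hD hq hp => ?_⟩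
  refine lt_of_le_of_lt ?_ (h D χ hD hq hp)
  have hlog : 1 < Real.log (D : ℝ) := one_lt_log_of_three_le hD
  have hP : 0 < Real.log (D : ℝ) ^ A := pow_pos (by linarith) A
  have hl : 0 < Real.log (Real.log (D : ℝ)) := loglog_pos_of_three_le hD
  rw [mul_div_mul_comm]
  refine mul_le_of_le_one_right (div_pos hc₁ hP).le ?_
  rw [div_le_one hl]
  exact loglog_three_le hD

/-- The `(log D)^{-A}(log log D)^{-1}` lower bound ⇒ the `(log D)^{-(A+1)}` lower bound (`log log D ≤ log D`).
[cite: Zhang2007LandauSiegel, §1 Theorem 1 (1.1)] -/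
theorem lOneLowerBound_succ_of_logLog {A : ℕ} (h : LOneLowerBoundLogLog A) :
    Skeleton.LOneLowerBound (A + 1) := by
  obtain ⟨c₁, hc₁, h⟩ := h
  refine ⟨c₁, hc₁, fun D _ χ hD hq hp => lt_of_le_of_lt ?_ (h D χ hD hq hp)⟩
  have hlog : 1 < Real.log (D : ℝ) := one_lt_log_of_three_le hD
  have hP : 0 < Real.log (D : ℝ) ^ A := pow_pos (by linarith) A
  have hl : 0 < Real.log (Real.log (D : ℝ)) := loglog_pos_of_three_le hD
  rw [pow_succ]
  exact div_le_div_of_nonneg_left hc₁.le (mul_pos hP hl)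
    (mul_le_mul_of_nonneg_left (loglog_le_log (by linarith)) hP.le)

/-- Zero-free region `(log D)^{-A}` ⇒ the `(log D)^{-A}(log log D)^{-1}` region (`c₂' = c₂ · log log 3`).
[cite: Zhang2007LandauSiegel, §1 remark after Theorem 2] -/
theorem zeroFreeRegionLogLog_of_zeroFreeRegion {A : ℕ} (h : Skeleton.ZeroFreeRegion A) :
    ZeroFreeRegionLogLog A := by
  obtain ⟨c₂, hc₂, h⟩ := h
  refine ⟨c₂ * Real.log (Real.log 3), mul_pos hc₂ loglog_three_pos, fun D _ χ hD hq hp σ hσ => ?_⟩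
  refine h D χ hD hq hp σ (lt_of_le_of_lt ?_ hσ)
  have hlog : 1 < Real.log (D : ℝ) := one_lt_log_of_three_le hD
  have hP : 0 < Real.log (D : ℝ) ^ A := pow_pos (by linarith) A
  have hl : 0 < Real.log (Real.log (D : ℝ)) := loglog_pos_of_three_le hD
  have : c₂ * Real.log (Real.log 3) / (Real.log (D : ℝ) ^ A * Real.log (Real.log (D : ℝ))) ≤
      c₂ / Real.log (D : ℝ) ^ A := by
    rw [mul_div_mul_comm]
    refine mul_le_of_le_one_right (div_pos hc₂ hP).le ?_
    rw [div_le_one hl]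
    exact loglog_three_le hD
  linarith

/-- The `(log D)^{-A}(log log D)^{-1}` zero-free region ⇒ the `(log D)^{-(A+1)}` region.
[cite: Zhang2007LandauSiegel, §1 Theorem 2] -/
theorem zeroFreeRegion_succ_of_logLog {A : ℕ} (h : ZeroFreeRegionLogLog A) :
    Skeleton.ZeroFreeRegion (A + 1) := by
  obtain ⟨c₂, hc₂, h⟩ := h
  refine ⟨c₂, hc₂, fun D _ χ hD hq hp σ hσ => h D χ hD hq hp σ (lt_of_le_of_lt ?_ hσ)⟩
  have hlog : 1 < Real.log (D : ℝ) := one_lt_log_of_three_le hD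
  have hP : 0 < Real.log (D : ℝ) ^ A := pow_pos (by linarith) A
  have hl : 0 < Real.log (Real.log (D : ℝ)) := loglog_pos_of_three_le hD
  have : c₂ / Real.log (D : ℝ) ^ (A + 1) ≤ c₂ / (Real.log (D : ℝ) ^ A * Real.log (Real.log (D : ℝ))) := by
    rw [pow_succ]
    exact div_le_div_of_nonneg_left hc₂.le (mul_pos hP hl)
      (mul_le_mul_of_nonneg_left (loglog_le_log (by linarith)) hP.le)
  linarith

/-- Monotonicity of the zero-free-region shape in the exponent (`log D ≥ 1` for `D ≥ 3`), the companion of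
`Section1.lOneLowerBound_mono`. [cite: Zhang2022LandauSiegel, §1 Theorem 2] -/
theorem zeroFreeRegion_mono {A B : ℕ} (hAB : A ≤ B) (h : Skeleton.ZeroFreeRegion A) :
    Skeleton.ZeroFreeRegion B := by
  obtain ⟨c₂, hc₂, h⟩ := h
  refine ⟨c₂, hc₂, fun D _ χ hD hq hp σ hσ => h D χ hD hq hp σ (lt_of_le_of_lt ?_ hσ)⟩
  have hlog : 1 ≤ Real.log (D : ℝ) := (one_lt_log_of_three_le hD).le
  have : c₂ / Real.log (D : ℝ) ^ B ≤ c₂ / Real.log (D : ℝ) ^ A :=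
    div_le_div_of_nonneg_left hc₂.le (pow_pos (by linarith) _) (pow_le_pow_right₀ hlog hAB)
  linarith

/-! ## The catalogue rows' doors -/

/-- The 2007 Theorem 1 sits between the exponents 17 and 18 of the 2022 shape:
`LOneLowerBound 17 → zhang2007Theorem1 → LOneLowerBound 18`. [cite: Zhang2007LandauSiegel, §1 Theorem 1 (1.1)] -/
theorem zhang2007Theorem1_sandwich :
    (Skeleton.LOneLowerBound 17 → zhang2007Theorem1) ∧ (zhang2007Theorem1 → Skeleton.LOneLowerBound 18) :=
  ⟨lOneLowerBoundLogLog_of_lOneLowerBound, lOneLowerBound_succ_of_logLog⟩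

/-- The 2007 Theorem 2 sits between the exponents 19 and 20: `ZeroFreeRegion 19 → zhang2007Theorem2 →
ZeroFreeRegion 20`. [cite: Zhang2007LandauSiegel, §1 Theorem 2] -/
theorem zhang2007Theorem2_sandwich :
    (Skeleton.ZeroFreeRegion 19 → zhang2007Theorem2) ∧ (zhang2007Theorem2 → Skeleton.ZeroFreeRegion 20) :=
  ⟨zeroFreeRegionLogLog_of_zeroFreeRegion, zeroFreeRegion_succ_of_logLog⟩

/-- **Door**: the 2007 claim implies the 2022 Theorem 1 (`18 ≤ 2022`) — as a catalogue row it is STRONGER than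
the target. Kernel-checked implication; asserts neither side. [cite: Zhang2007LandauSiegel, §1 Theorem 1 (1.1)] -/
theorem theorem1_of_zhang2007Theorem1 (h : zhang2007Theorem1) : Skeleton.Theorem1 :=
  Section1.lOneLowerBound_mono (by norm_num) (lOneLowerBound_succ_of_logLog h)

/-- **Door**: the 2007 Theorem 2 implies the 2022 Theorem 2 (`20 ≤ 2024`). [cite: Zhang2007LandauSiegel, §1 Theorem 2] -/
theorem theorem2_of_zhang2007Theorem2 (h : zhang2007Theorem2) : Skeleton.Theorem2 :=
  zeroFreeRegion_mono (by norm_num) (zeroFreeRegion_succ_of_logLog h)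

/-- The 2007 Theorem 1 also yields the 2022 Theorem 2 (via the tree's `A ↦ A + 2` shift
`Skeleton.zeroFreeRegion_of_lOneLowerBound`: exponent `20 ≤ 2024`). [cite: Zhang2007LandauSiegel, §1 Theorems 1–2] -/
theorem theorem2_of_zhang2007Theorem1 (h : zhang2007Theorem1) : Skeleton.Theorem2 :=
  zeroFreeRegion_mono (by norm_num) (Skeleton.zeroFreeRegion_of_lOneLowerBound 18 (lOneLowerBound_succ_of_logLog h))

/-- **Door**: any exponent claim below `B ≤ 2023` implies Theorem 1 as stated. [cite: Zhang2022LandauSiegel, §1 Theorem 1] -/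
theorem theorem1_of_exponentBelow {B : ℕ} (hB : B ≤ 2023) (h : ExponentBelow B) : Skeleton.Theorem1 := by
  obtain ⟨A, hA, hL⟩ := h
  exact Section1.lOneLowerBound_mono (by omega) hL

/-- `ExponentBelow` is monotone in the ceiling. [cite: Zhang2022LandauSiegel, §1 Theorem 1] -/
theorem exponentBelow_mono {B B' : ℕ} (hBB' : B ≤ B') (h : ExponentBelow B) : ExponentBelow B' := by
  obtain ⟨A, hA, hL⟩ := h
  exact ⟨A, lt_of_lt_of_le hA hBB', hL⟩

/-- Theorem 1 itself is the instance `ExponentBelow 2023`; the 2007 claim gives `ExponentBelow 19`.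
[cite: Zhang2022LandauSiegel, §1 Theorem 1] -/
theorem exponentBelow_instances :
    (Skeleton.Theorem1 → ExponentBelow 2023) ∧ (zhang2007Theorem1 → ExponentBelow 19) :=
  ⟨fun h => ⟨2022, by norm_num, h⟩, fun h => ⟨18, by norm_num, lOneLowerBound_succ_of_logLog h⟩⟩

end Literature.NumberTheory.LFunctions.Zhang2022.Repair.Catalogue

end
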